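import Summits.NavierStokesRegularity.NavierStokesRegularity.Theses.LerayQuarterDissipation
import Summits.NavierStokesRegularity.NavierStokesRegularity.Theorems.LerayQuarterDissipationFiniteDissipationLiouvilleStubSmallDissipationGap
import Summits.NavierStokesRegularity.NavierStokesRegularity.Theorems.LerayQuarterDissipationFiniteDissipationLiouvilleFinalTrace
import Summits.NavierStokesRegularity.NavierStokesRegularity.Theorems.LerayQuarterDissipationRecurrentDissipativeLiouvilleCriticalRecurrent
import Summits.NavierStokesRegularity.NavierStokesRegularity.Theorems.LerayQuarterDissipationFiniteDissipationLiouvilleTraceWeighted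
import Summits.NavierStokesRegularity.NavierStokesRegularity.Theorems.LerayQuarterDissipationFiniteDissipationLiouvilleTraceVorticityFloor
import Summits.NavierStokesRegularity.NavierStokesRegularity.Theorems.LerayQuarterDissipationFiniteDissipationLiouvilleCriticalPoint
import Summits.NavierStokesRegularity.NavierStokesRegularity.Theorems.LerayQuarterDissipationFiniteDissipationLiouvilleEnvelopePV
import Summits.NavierStokesRegularity.NavierStokesRegularity.Theorems.LerayQuarterDissipationFiniteDissipationLiouvilleAbsoluteFloors
import Summits.NavierStokesRegularity.NavierStokesRegularity.Theorems.LerayQuarterDissipationFiniteDissipationLiouvilleDssUniformThreshold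
import Summits.NavierStokesRegularity.NavierStokesRegularity.Theorems.LerayQuarterDissipationFiniteDissipationLiouvilleDssFactors
import Summits.NavierStokesRegularity.NavierStokesRegularity.Theorems.LerayQuarterDissipationFiniteDissipationLiouvilleVorticityAlignmentRegime
import Summits.NavierStokesRegularity.NavierStokesRegularity.Theorems.LerayQuarterDissipationFiniteDissipationLiouvilleVorticityAlignmentLocal
import Summits.NavierStokesRegularity.NavierStokesRegularity.Theorems.LerayQuarterDissipationFiniteDissipationLiouvillePlanarityLocal
import Summits.NavierStokesRegularity.NavierStokesRegularity.Theorems.LerayQuarterDissipationFiniteDissipationLiouvilleUnidirectionalLocal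
import Summits.NavierStokesRegularity.NavierStokesRegularity.Theorems.LerayQuarterDissipationFiniteDissipationLiouvilleAlignmentConcentrating
import Summits.NavierStokesRegularity.NavierStokesRegularity.Theorems.LerayQuarterDissipationFiniteDissipationLiouvilleTraceMorrey
import Summits.NavierStokesRegularity.NavierStokesRegularity.Theorems.LerayQuarterDissipationFiniteDissipationLiouvilleEnergyFloor
import Summits.NavierStokesRegularity.NavierStokesRegularity.Theorems.LerayQuarterDissipationFiniteDissipationLiouvilleFinalDatumVorticityMinimal
import Summits.NavierStokesRegularity.NavierStokesRegularity.Theorems.LerayQuarterDissipationFiniteDissipationLiouvilleEnergyReturn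
import HarnessLib

/-!
# Crux `FiniteDissipationLiouville` (stmt-NavierStokesRegularity-22144): THE PORTRAIT REDUCTION AS A
# SORRY-FREE THEOREM — the v19 portrait statement implies the crux

Theorems file of route `LerayQuarterDissipation` (lead prover ns-lqd-lead g9; `--supports` the
crux, line `birth`). Navier–Stokes regularity is NOT proved by anything here; no summit is.

`finiteDissipationLiouville_of_portrait`: the registered stub `stub_envelopeCriticalLiouville` of
skeleton v19 (`Cruxes/FiniteDissipationLiouville/Lines/birth.lean`), taken as a HYPOTHESIS `h`,
implies the crux — the skeleton's composition `FiniteDissipationLiouville_of` made importable: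
small `K` by the gap (p579719); otherwise the recurrent CRITICAL element (ns-lqd-p1) and the
kernel-checked portrait of leads g3–g9 discharge every hypothesis of `h`, which then declares the
element regular. So the portrait statement is SUFFICIENT for the crux by a kernel theorem (and
necessary: `…EnvelopeIff`, p613275). `h` is an OPEN PROBLEM (it contains Bradshaw–Tsai OP 5.1,
`…Hardness`, p588754); nothing is proved about it here.
-/

noncomputable section
set_option linter.dupNamespace false
namespace Summit.NavierStokesRegularity.NavierStokesRegularity.Theorems.FiniteDissipationLiouville.PortraitReduction

open MeasureTheory Set Filter Topology
open scoped RealInnerProductSpace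

/-- **The v19 portrait statement implies the crux `FiniteDissipationLiouville`.** The hypothesis
is, verbatim, the registered stub `stub_envelopeCriticalLiouville` of skeleton v19 of line `birth`
(an open problem containing Bradshaw–Tsai OP 5.1); the proof is the skeleton's composition with
the landed portrait theorems. [cite: KochNadirashviliSereginSverak2009, §4 (arXiv:0709.3599 p. 8)] -/
theorem finiteDissipationLiouville_of_portrait
    (h :
    ∀ (C A Kc : ℝ) (W : ℝ → EuclideanSpace ℝ (Fin 3) → EuclideanSpace ℝ (Fin 3)),
      Literature.Analysis.FluidPDE.IsTypeIAncientMild C W →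
      Literature.Analysis.FluidPDE.HasTypeIDecay A W →
      (∀ s : ℝ, s < 0 → ∫⁻ x, ‖fderiv ℝ (W s) x‖ₑ ^ 2 ≤ ENNReal.ofReal (Kc / Real.sqrt (-s))) →
      (∀ K' : ℝ, K' < Kc → ∀ v : ℝ → EuclideanSpace ℝ (Fin 3) → EuclideanSpace ℝ (Fin 3),
        Literature.Analysis.FluidPDE.IsTypeIAncientMild C v →
        (∀ s : ℝ, s < 0 → ∫⁻ x, ‖fderiv ℝ (v s) x‖ₑ ^ 2 ≤ ENNReal.ofReal (K' / Real.sqrt (-s))) →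
        ¬ (∀ r > 0, ∀ M : ℝ, ∃ t ∈ Set.Ioo (-(r ^ 2)) (0 : ℝ),
          ∃ x ∈ Metric.ball (0 : EuclideanSpace ℝ (Fin 3)) r, M < ‖v t x‖)) →
      (∀ ε > 0, ∀ R > 1, ∃ L > 0, ∀ a : ℝ, ∃ σ ∈ Set.Icc a (a + L),
        ∀ s ∈ Set.Icc (-(R ^ 2)) (-(R⁻¹) ^ 2),
        ∀ y ∈ Metric.closedBall (0 : EuclideanSpace ℝ (Fin 3)) R,
          ‖Real.exp σ • W (Real.exp (2 * σ) * s) (Real.exp σ • y) - W s y‖ ≤ ε) →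
      (∀ ε : ℝ, 0 < ε → ∃ Λ : ℝ, 1 < Λ ∧ ∀ τ : ℝ, τ < 0 →
        ∃ t ∈ Set.Icc (Λ ^ 2 * τ) (τ / Λ ^ 2),
          ENNReal.ofReal ((Kc - ε) / Real.sqrt (-t)) < ∫⁻ x, ‖fderiv ℝ (W t) x‖ₑ ^ 2) →
      (∃ Q : ℝ → EuclideanSpace ℝ (Fin 3) → ℝ,
        Literature.Analysis.FluidPDE.IsClassicalNSSolutionOn (Set.Iio (0 : ℝ)) 1 0 W Q ∧
          Theorems.RellichScarScarRigidity.ScaleInvariantBounds W Q) →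
      (∃ Kg : ℝ, 0 ≤ Kg ∧ ∀ t < 0, ∀ R > 0,
        ∫⁻ x in {x : EuclideanSpace ℝ (Fin 3) | R * Real.sqrt (-t) ≤ ‖x‖}, ‖fderiv ℝ (W t) x‖ₑ ^ 2 ≤
          ENNReal.ofReal (Kg / (R * Real.sqrt (-t)))) →
      (∃ δ₀ > 0, ∃ T₀ > 0, ∀ tbar ∈ Set.Ioo (-T₀) (0 : ℝ),
        ∃ x ∈ Metric.ball (0 : EuclideanSpace ℝ (Fin 3)) 1,
          δ₀ < ‖Real.sqrt (-tbar) • ((-tbar) • deriv (fun τ => W τ x) tbar - (1 / 2 : ℝ) • W tbar x -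
            (1 / 2 : ℝ) • fderiv ℝ (W tbar) x x)‖) →
      (∃ θ > 0, ∀ t < 0, ∃ y, θ < Real.sqrt (-t) * ‖W t y‖) →
      (∀ x₁ : EuclideanSpace ℝ (Fin 3), x₁ ≠ 0 →
        ¬ (∀ r > 0, ∀ M : ℝ, ∃ t ∈ Set.Ioo (-(r ^ 2)) (0 : ℝ),
          ∃ x ∈ Metric.ball (0 : EuclideanSpace ℝ (Fin 3)) r, M < ‖W t (x₁ + x)‖)) →
      (∃ (φ : EuclideanSpace ℝ (Fin 3) → EuclideanSpace ℝ (Fin 3)) (L : ℝ),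
        Literature.Analysis.FunctionSpaces.IsTestFunctionOn
            (⊤ : TopologicalSpace.Opens (EuclideanSpace ℝ (Fin 3))) φ ∧ L ≠ 0 ∧
          Filter.Tendsto (fun t => ∫ x, ⟪W t x, φ x⟫) (𝓝[<] 0) (𝓝 L)) →
      (∃ ε > 0, ∀ ρ > 0, ∃ (ψ : EuclideanSpace ℝ (Fin 3) → EuclideanSpace ℝ (Fin 3)) (T : ℝ),
        Literature.Analysis.FunctionSpaces.IsTestFunctionOn
            (⊤ : TopologicalSpace.Opens (EuclideanSpace ℝ (Fin 3))) ψ ∧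
          (∀ x, ψ x ≠ 0 → ‖x‖ < ρ) ∧
          Filter.Tendsto (fun t => ∫ x, ⟪W t x, ψ x⟫) (𝓝[<] 0) (𝓝 T) ∧
          ε * (∫ x, ‖ψ x‖ ^ (3 / 2 : ℝ)) ^ (2 / 3 : ℝ) < |T|) →
      (∃ ε > 0, ∀ R > 0, ∃ (ψ : EuclideanSpace ℝ (Fin 3) → EuclideanSpace ℝ (Fin 3)) (T : ℝ),
        Literature.Analysis.FunctionSpaces.IsTestFunctionOn
            (⊤ : TopologicalSpace.Opens (EuclideanSpace ℝ (Fin 3))) ψ ∧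
          (∀ x, ψ x ≠ 0 → R < ‖x‖) ∧
          Filter.Tendsto (fun t => ∫ x, ⟪W t x, ψ x⟫) (𝓝[<] 0) (𝓝 T) ∧
          ε * (∫ x, ‖ψ x‖ ^ (3 / 2 : ℝ)) ^ (2 / 3 : ℝ) < |T|) →
      (∃ θ > 0, ∀ ρ > 0, ∃ (ψ : EuclideanSpace ℝ (Fin 3) → EuclideanSpace ℝ (Fin 3)) (T : ℝ),
        Literature.Analysis.FunctionSpaces.IsTestFunctionOn
            (⊤ : TopologicalSpace.Opens (EuclideanSpace ℝ (Fin 3))) ψ ∧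
          (∀ x, ψ x ≠ 0 → ‖x‖ < ρ) ∧
          Filter.Tendsto (fun t => ∫ x, ⟪W t x, ψ x⟫) (𝓝[<] 0) (𝓝 T) ∧
          θ * (∫ x, ‖ψ x‖ / ‖x‖) < |T|) →
      (∃ θ > 0, ∀ R > 0, ∃ (ψ : EuclideanSpace ℝ (Fin 3) → EuclideanSpace ℝ (Fin 3)) (T : ℝ),
        Literature.Analysis.FunctionSpaces.IsTestFunctionOn
            (⊤ : TopologicalSpace.Opens (EuclideanSpace ℝ (Fin 3))) ψ ∧
          (∀ x, ψ x ≠ 0 → R < ‖x‖) ∧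
          Filter.Tendsto (fun t => ∫ x, ⟪W t x, ψ x⟫) (𝓝[<] 0) (𝓝 T) ∧
          θ * (∫ x, ‖ψ x‖ / ‖x‖) < |T|) →
      (∀ e : EuclideanSpace ℝ (Fin 3), ‖e‖ = 1 → ∀ R₁ : ℝ,
        ∃ (ψ : EuclideanSpace ℝ (Fin 3) → EuclideanSpace ℝ (Fin 3)) (L : ℝ),
          Literature.Analysis.FunctionSpaces.IsTestFunctionOn
              (⊤ : TopologicalSpace.Opens (EuclideanSpace ℝ (Fin 3))) ψ ∧
            (∀ x, ψ x ≠ 0 → R₁ < ⟪x, e⟫) ∧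
            Filter.Tendsto (fun t => ∫ x, ⟪W t x, Literature.Analysis.FluidPDE.curl ψ x⟫)
              (𝓝[<] 0) (𝓝 L) ∧ L ≠ 0) →
      (∀ r > 0, ∃ (ψ : EuclideanSpace ℝ (Fin 3) → EuclideanSpace ℝ (Fin 3)) (L : ℝ),
        Literature.Analysis.FunctionSpaces.IsTestFunctionOn
            (⊤ : TopologicalSpace.Opens (EuclideanSpace ℝ (Fin 3))) ψ ∧
          (∀ x, ψ x ≠ 0 → x ≠ 0 ∧ ‖x‖ < r) ∧
          Filter.Tendsto (fun t => ∫ x, ⟪W t x, Literature.Analysis.FluidPDE.curl ψ x⟫)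
            (𝓝[<] 0) (𝓝 L) ∧ L ≠ 0) →
      (∃ lam₀ > 1, ∀ c : ℝ, 1 < c → c < lam₀ →
        ¬ (∀ t : ℝ, t < 0 → ∀ x, c • W (c ^ 2 * t) (c • x) = W t x)) →
      (∃ θ > 0, ∀ ρ > 0, ∃ (ψ : EuclideanSpace ℝ (Fin 3) → EuclideanSpace ℝ (Fin 3)) (T : ℝ),
        Literature.Analysis.FunctionSpaces.IsTestFunctionOn
            (⊤ : TopologicalSpace.Opens (EuclideanSpace ℝ (Fin 3))) ψ ∧
          (∀ x, ψ x ≠ 0 → ‖x‖ < ρ) ∧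
          Filter.Tendsto (fun t => ∫ x, ⟪W t x, Literature.Analysis.FluidPDE.curl ψ x⟫)
            (𝓝[<] 0) (𝓝 T) ∧
          θ * (∫ x, ‖ψ x‖ / ‖x‖ ^ 2) < |T|) →
      (∃ θ > 0, ∀ R > 0, ∃ (ψ : EuclideanSpace ℝ (Fin 3) → EuclideanSpace ℝ (Fin 3)) (T : ℝ),
        Literature.Analysis.FunctionSpaces.IsTestFunctionOn
            (⊤ : TopologicalSpace.Opens (EuclideanSpace ℝ (Fin 3))) ψ ∧
          (∀ x, ψ x ≠ 0 → R < ‖x‖) ∧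
          Filter.Tendsto (fun t => ∫ x, ⟪W t x, Literature.Analysis.FluidPDE.curl ψ x⟫)
            (𝓝[<] 0) (𝓝 T) ∧
          θ * (∫ x, ‖ψ x‖ / ‖x‖ ^ 2) < |T|) →
      (∀ c : ℝ, 0 < c → c ≠ 1 → (∀ t : ℝ, t < 0 → ∀ x, c • W (c ^ 2 * t) (c • x) = W t x) →
        ∃ lam : ℝ, 1 < lam ∧ (∀ t : ℝ, t < 0 → ∀ x, lam • W (lam ^ 2 * t) (lam • x) = W t x) ∧
          ∀ c' : ℝ, 0 < c' →
            ((∀ t : ℝ, t < 0 → ∀ x, c' • W (c' ^ 2 * t) (c' • x) = W t x) ↔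
              ∃ k : ℤ, c' = lam ^ k)) →
      (∃ (L₀ L₁ M : ℝ) (u₀ : EuclideanSpace ℝ (Fin 3) → EuclideanSpace ℝ (Fin 3))
          (Du₀ : EuclideanSpace ℝ (Fin 3) →
            ((EuclideanSpace ℝ (Fin 3)) →L[ℝ] (EuclideanSpace ℝ (Fin 3)))),
        (∀ t : ℝ, t < 0 → ∫⁻ x, ‖W t x - u₀ x‖ₑ ^ 2 ≤ ENNReal.ofReal (M * Real.sqrt (-t))) ∧
        (∃ δ > 0, ∀ t : ℝ, t < 0 →
          ENNReal.ofReal (δ ^ 2 * Real.sqrt (-t)) < ∫⁻ x, ‖W t x - u₀ x‖ₑ ^ 2) ∧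
        (∀ ψ : EuclideanSpace ℝ (Fin 3) → EuclideanSpace ℝ (Fin 3),
          Literature.Analysis.FunctionSpaces.IsTestFunctionOn
              (⊤ : TopologicalSpace.Opens (EuclideanSpace ℝ (Fin 3))) ψ →
          Filter.Tendsto (fun t => ∫ x, ⟪W t x, ψ x⟫) (𝓝[<] 0) (𝓝 (∫ x, ⟪u₀ x, ψ x⟫))) ∧
        (∃ ε₀ > 0, ∀ ρ > 0, ENNReal.ofReal (ε₀ ^ 2 * ρ) <
          ∫⁻ x in Metric.ball (0 : EuclideanSpace ℝ (Fin 3)) ρ, ‖u₀ x‖ₑ ^ 2) ∧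
        (∀ ρ > 0, ∫⁻ x in Metric.ball (0 : EuclideanSpace ℝ (Fin 3)) ρ, ‖u₀ x‖ₑ ^ 2 ≤
          ENNReal.ofReal (3 * (MeasureTheory.volume : MeasureTheory.Measure
            (EuclideanSpace ℝ (Fin 3))).real (Metric.ball 0 1) * A ^ 2 * ρ)) ∧
        Literature.Analysis.FluidPDE.IsWeaklyDivFree u₀ ∧
        (∃ Lω : ℝ, 0 ≤ Lω ∧
          (∀ t : ℝ, t < 0 → ∫⁻ x, ‖fderiv ℝ (W t) x - Du₀ x‖ₑ ≤ ENNReal.ofReal (Lω * Real.sqrt (-t))) ∧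
          (∀ t : ℝ, t < 0 → ∫⁻ x, ‖Literature.Analysis.FluidPDE.curl (W t) x -
              Literature.Analysis.FluidPDE.curlCLM (Du₀ x)‖ₑ ≤ ENNReal.ofReal (Lω * Real.sqrt (-t))) ∧
          (∀ ρ > 0, ∫⁻ x in Metric.ball (0 : EuclideanSpace ℝ (Fin 3)) ρ,
              ‖Literature.Analysis.FluidPDE.curlCLM (Du₀ x)‖ₑ ≤ ENNReal.ofReal (Lω * ρ))) ∧
        (∀ ψ : EuclideanSpace ℝ (Fin 3) → EuclideanSpace ℝ (Fin 3),
          Literature.Analysis.FunctionSpaces.IsTestFunctionOn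
              (⊤ : TopologicalSpace.Opens (EuclideanSpace ℝ (Fin 3))) ψ →
          Filter.Tendsto (fun t => ∫ x, ⟪W t x, Literature.Analysis.FluidPDE.curl ψ x⟫) (𝓝[<] 0)
            (𝓝 (∫ x, ⟪Literature.Analysis.FluidPDE.curlCLM (Du₀ x), ψ x⟫))) ∧
        (∀ x : EuclideanSpace ℝ (Fin 3), x ≠ 0 → ∀ t : ℝ, t < 0 →
          ‖W t x - u₀ x‖ ≤ L₀ * (-t) / ‖x‖ ^ 3) ∧
        (∀ x : EuclideanSpace ℝ (Fin 3), x ≠ 0 → ‖u₀ x‖ ≤ A / ‖x‖) ∧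
        (∀ x : EuclideanSpace ℝ (Fin 3), x ≠ 0 → ∀ t : ℝ, t < 0 →
          ‖fderiv ℝ (W t) x - Du₀ x‖ ≤ L₁ * (-t) / ‖x‖ ^ 4) ∧
        (∀ x : EuclideanSpace ℝ (Fin 3), x ≠ 0 → ‖Du₀ x‖ ≤ L₁ / ‖x‖ ^ 2) ∧
        (∀ x : EuclideanSpace ℝ (Fin 3), x ≠ 0 → HasFDerivAt u₀ (Du₀ x) x) ∧
        (∀ x : EuclideanSpace ℝ (Fin 3), x ≠ 0 →
          Literature.Analysis.FluidPDE.VectorCalculus.divergence u₀ x = 0) ∧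
        (∀ (ψ : EuclideanSpace ℝ (Fin 3) → EuclideanSpace ℝ (Fin 3)) (r : ℝ), 0 < r →
          Literature.Analysis.FunctionSpaces.IsTestFunctionOn
              (⊤ : TopologicalSpace.Opens (EuclideanSpace ℝ (Fin 3))) ψ →
          (∀ x, ψ x ≠ 0 → r < ‖x‖) →
          Filter.Tendsto (fun t => ∫ x, ⟪W t x, ψ x⟫) (𝓝[<] 0) (𝓝 (∫ x, ⟪u₀ x, ψ x⟫)))) →
      (∃ δ > 0, ∀ t < 0,
        ∃ x ∈ Metric.ball (0 : EuclideanSpace ℝ (Fin 3)) (δ⁻¹ * Real.sqrt (-t)),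
        ∃ y ∈ Metric.ball (0 : EuclideanSpace ℝ (Fin 3)) (δ⁻¹ * Real.sqrt (-t)),
          δ < (-t) * ‖Literature.Analysis.FluidPDE.curl (W t) x‖ ∧
          δ < (-t) * ‖Literature.Analysis.FluidPDE.curl (W t) y‖ ∧
          δ < ‖Literature.Analysis.FluidPDE.vorticityDirection (Literature.Analysis.FluidPDE.curl (W t)) x -
              Literature.Analysis.FluidPDE.vorticityDirection (Literature.Analysis.FluidPDE.curl (W t)) y‖ ∧
          δ < ‖Literature.Analysis.FluidPDE.vorticityDirection (Literature.Analysis.FluidPDE.curl (W t)) x +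
              Literature.Analysis.FluidPDE.vorticityDirection (Literature.Analysis.FluidPDE.curl (W t)) y‖) →
      ¬ (∃ d : ℝ, 0 ≤ d ∧ ∃ r₀ : ℝ, 0 < r₀ ∧ ∃ η : ℝ → ℝ, Filter.Tendsto η (𝓝[>] 0) (𝓝 0) ∧
          ∀ t ∈ Set.Ioo (-(r₀ ^ 2)) (0 : ℝ), ∀ x ∈ Metric.ball (0 : EuclideanSpace ℝ (Fin 3)) r₀,
            ∀ y ∈ Metric.ball (0 : EuclideanSpace ℝ (Fin 3)) r₀,
              d < ‖Literature.Analysis.FluidPDE.curl (W t) x‖ →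
              d < ‖Literature.Analysis.FluidPDE.curl (W t) y‖ →
              min ‖Literature.Analysis.FluidPDE.vorticityDirection (Literature.Analysis.FluidPDE.curl (W t)) x -
                    Literature.Analysis.FluidPDE.vorticityDirection (Literature.Analysis.FluidPDE.curl (W t)) y‖
                  ‖Literature.Analysis.FluidPDE.vorticityDirection (Literature.Analysis.FluidPDE.curl (W t)) x +
                    Literature.Analysis.FluidPDE.vorticityDirection (Literature.Analysis.FluidPDE.curl (W t)) y‖ ≤
                η ‖x - y‖) →
      (∃ δ > 0, ∀ t < 0, ∀ e : EuclideanSpace ℝ (Fin 3), ‖e‖ = 1 →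
        ∃ x ∈ Metric.ball (0 : EuclideanSpace ℝ (Fin 3)) (δ⁻¹ * Real.sqrt (-t)),
          δ < (-t) * ‖fderiv ℝ (W t) x e‖) →
      (∃ δ > 0, ∀ t < 0,
        ∃ x ∈ Metric.ball (0 : EuclideanSpace ℝ (Fin 3)) (δ⁻¹ * Real.sqrt (-t)),
        ∃ y ∈ Metric.ball (0 : EuclideanSpace ℝ (Fin 3)) (δ⁻¹ * Real.sqrt (-t)),
          δ < Real.sqrt (-t) * ‖W t x‖ ∧ δ < Real.sqrt (-t) * ‖W t y‖ ∧
          δ < ‖‖W t x‖⁻¹ • W t x - ‖W t y‖⁻¹ • W t y‖ ∧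
          δ < ‖‖W t x‖⁻¹ • W t x + ‖W t y‖⁻¹ • W t y‖) →
      ¬ (∃ r₀ : ℝ, 0 < r₀ ∧ r₀ < 1 ∧ ∃ d : ℝ, 0 < d ∧ ∃ η : ℝ → ℝ,
          MonotoneOn η (Set.Ici 0) ∧ ContinuousOn η (Set.Ici 0) ∧ η 0 = 0 ∧
          ∀ t ∈ Set.Ioo (-1 : ℝ) 0, ∀ x ∈ Metric.ball (0 : EuclideanSpace ℝ (Fin 3)) r₀,
            ∀ y ∈ Metric.ball (0 : EuclideanSpace ℝ (Fin 3)) r₀,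
              d < ‖Literature.Analysis.FluidPDE.curl (W t) x‖ →
              d < ‖Literature.Analysis.FluidPDE.curl (W t) y‖ →
              ‖Literature.Analysis.FluidPDE.vorticityDirection (Literature.Analysis.FluidPDE.curl (W t)) x -
                  Literature.Analysis.FluidPDE.vorticityDirection (Literature.Analysis.FluidPDE.curl (W t)) y‖ ≤
                η ‖x - y‖) →
      (∀ r > 0, ∃ δ > 0, ∀ t < 0,
        ∃ x ∈ Metric.ball (0 : EuclideanSpace ℝ (Fin 3)) (r * Real.sqrt (-t)),
        ∃ y ∈ Metric.ball (0 : EuclideanSpace ℝ (Fin 3)) (r * Real.sqrt (-t)),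
          δ < (-t) * ‖Literature.Analysis.FluidPDE.curl (W t) x‖ ∧
          δ < (-t) * ‖Literature.Analysis.FluidPDE.curl (W t) y‖ ∧
          δ < ‖Literature.Analysis.FluidPDE.vorticityDirection (Literature.Analysis.FluidPDE.curl (W t)) x -
              Literature.Analysis.FluidPDE.vorticityDirection (Literature.Analysis.FluidPDE.curl (W t)) y‖ ∧
          δ < ‖Literature.Analysis.FluidPDE.vorticityDirection (Literature.Analysis.FluidPDE.curl (W t)) x +
              Literature.Analysis.FluidPDE.vorticityDirection (Literature.Analysis.FluidPDE.curl (W t)) y‖) →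
      (∀ r > 0, ∃ δ > 0, ∀ t < 0, ∀ e : EuclideanSpace ℝ (Fin 3), ‖e‖ = 1 →
        ∃ x ∈ Metric.ball (0 : EuclideanSpace ℝ (Fin 3)) (r * Real.sqrt (-t)),
          δ < (-t) * ‖fderiv ℝ (W t) x e‖) →
      (∀ r > 0, ∃ δ > 0, ∀ t < 0,
        ∃ x ∈ Metric.ball (0 : EuclideanSpace ℝ (Fin 3)) (r * Real.sqrt (-t)),
        ∃ y ∈ Metric.ball (0 : EuclideanSpace ℝ (Fin 3)) (r * Real.sqrt (-t)),
          δ < Real.sqrt (-t) * ‖W t x‖ ∧ δ < Real.sqrt (-t) * ‖W t y‖ ∧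
          δ < ‖‖W t x‖⁻¹ • W t x - ‖W t y‖⁻¹ • W t y‖ ∧
          δ < ‖‖W t x‖⁻¹ • W t x + ‖W t y‖⁻¹ • W t y‖) →
      ¬ (∃ a : ℝ, 0 < a ∧ ∃ d : ℝ, 0 ≤ d ∧ ∃ η : ℝ → ℝ, Filter.Tendsto η (𝓝[>] 0) (𝓝 0) ∧
          ∃ tseq : ℕ → ℝ, (∀ n, tseq n < 0) ∧ Filter.Tendsto tseq Filter.atTop (𝓝 0) ∧
          ∀ n, ∀ x ∈ Metric.ball (0 : EuclideanSpace ℝ (Fin 3)) (a * Real.sqrt (-tseq n)),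
            ∀ y ∈ Metric.ball (0 : EuclideanSpace ℝ (Fin 3)) (a * Real.sqrt (-tseq n)),
              d < ‖Literature.Analysis.FluidPDE.curl (W (tseq n)) x‖ →
              d < ‖Literature.Analysis.FluidPDE.curl (W (tseq n)) y‖ →
              min ‖Literature.Analysis.FluidPDE.vorticityDirection
                      (Literature.Analysis.FluidPDE.curl (W (tseq n))) x -
                    Literature.Analysis.FluidPDE.vorticityDirection
                      (Literature.Analysis.FluidPDE.curl (W (tseq n))) y‖
                  ‖Literature.Analysis.FluidPDE.vorticityDirection
                      (Literature.Analysis.FluidPDE.curl (W (tseq n))) x +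
                    Literature.Analysis.FluidPDE.vorticityDirection
                      (Literature.Analysis.FluidPDE.curl (W (tseq n))) y‖ ≤
                η ‖x - y‖) →
      (∀ r > 0, ∃ δ > 0, ∀ t < 0, ENNReal.ofReal (δ * Real.sqrt (-t)) <
        ∫⁻ x in Metric.ball (0 : EuclideanSpace ℝ (Fin 3)) (r * Real.sqrt (-t)), ‖W t x‖ₑ ^ 2) →
      (∃ Λ : NNReal, ∀ (x₀ : EuclideanSpace ℝ (Fin 3)) (r : ℝ), 0 < r →
        ∀ t ∈ Set.Ioo (-r ^ 2) 0,
          ∫⁻ x in Metric.ball x₀ r, ‖W t x‖ₑ ^ 2 ≤ ENNReal.ofReal r * Λ) →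
      ¬ (∀ r > 0, ∀ M : ℝ, ∃ t ∈ Set.Ioo (-(r ^ 2)) (0 : ℝ),
          ∃ x ∈ Metric.ball (0 : EuclideanSpace ℝ (Fin 3)) r, M < ‖W t x‖)) :
    Theses.LerayQuarterDissipation.FiniteDissipationLiouville := by
  intro C K ū hū hD hsing
  obtain ⟨K₀, hK₀, hgap⟩ := Theorems.FiniteDissipationLiouville.Birth.stub_smallDissipationGap
  by_cases hK : K ≤ K₀
  · have hz := hgap C K ū hK hū hD
    obtain ⟨t, ht, x, -, hM⟩ := hsing 1 one_pos 0
    rw [hz t ht.2 x, norm_zero] at hM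
    exact lt_irrefl _ hM
  · obtain ⟨K₁, -, hce⟩ := Theorems.FiniteDissipationLiouville.CriticalElement.exists_recurrent_criticalElement
    obtain ⟨Kc, w, -, -, hw, hDw, hsw, hrec, hmin, hsat⟩ := hce C K ū hū hD hsing
    obtain ⟨A, -, hA⟩ := Theorems.FiniteDissipationLiouville.Envelope.envelope_of_minimal hmin
    obtain ⟨δ₀, hδ₀, hpv⟩ := Theorems.FiniteDissipationLiouville.Envelope.pv_unsteadiness_floor_of_minimal hmin
    obtain ⟨T₀, hT₀, hpvw⟩ := hpv w hw hDw hsw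
    obtain ⟨θ, hθ, hsup⟩ := Theorems.FiniteDissipationLiouville.AbsoluteFloors.sup_floor_absolute
    obtain ⟨θ₁, hθ₁, hθ₁f⟩ :=
      Theorems.FiniteDissipationLiouville.Birth.Apex.trace_weighted_apex_floor_of_singular C Kc
    obtain ⟨θ₂, hθ₂, hθ₂f⟩ :=
      Theorems.FiniteDissipationLiouville.Birth.Apex.trace_weighted_farField_floor_of_singular C Kc
    obtain ⟨θ₃, hθ₃, hθ₃f⟩ :=
      Theorems.FiniteDissipationLiouville.Birth.Apex.trace_vorticity_apex_floor_of_singular C Kc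
    obtain ⟨θ₄, hθ₄, hθ₄f⟩ :=
      Theorems.FiniteDissipationLiouville.Birth.Apex.trace_vorticity_farField_floor_of_singular C Kc
    obtain ⟨lam₀, hlam₀, hthr⟩ := Theorems.FiniteDissipationLiouville.Birth.exists_pastDss_threshold_unif C Kc
    obtain ⟨δ₁, hδ₁, hδ₁f⟩ :=
      Theorems.FiniteDissipationLiouville.VorticityAlignment.directionOscillation_floor_of_singular C Kc
    obtain ⟨δ₂, hδ₂, hδ₂f⟩ := Theorems.FiniteDissipationLiouville.Planarity.planarity_floor_of_singular C Kc
    obtain ⟨δ₃, hδ₃, hδ₃f⟩ :=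
      Theorems.FiniteDissipationLiouville.Unidirectional.unidirectionality_floor_of_singular C Kc
    obtain ⟨Q, hQcl, hSIB⟩ :=
      Theorems.FiniteDissipationLiouville.Envelope.scaleInvariantBounds_of_minimal hmin hw hDw hsw
    obtain ⟨u₀, Du₀, L₀, L₁, Me, -, hL₁nn, -, hrate, henv, hgrate, hgenv, hderiv, hdiv, hener⟩ :=
      Theorems.FiniteDissipationLiouville.EnergyRemainder.exists_finalDatum_profile_energy hw
        (hA w hw hDw hsw) hSIB
    obtain ⟨Λ, hΛ⟩ := Theorems.FiniteDissipationLiouville.Birth.Apex.lintegral_ball_sq_le_unif Kc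
    have hu₀m := Theorems.FiniteDissipationLiouville.EnergyRemainder.aestronglyMeasurable_finalDatum hw hrate
    have htr : ∀ ψ : EuclideanSpace ℝ (Fin 3) → EuclideanSpace ℝ (Fin 3),
        Literature.Analysis.FunctionSpaces.IsTestFunctionOn
            (⊤ : TopologicalSpace.Opens (EuclideanSpace ℝ (Fin 3))) ψ →
        Filter.Tendsto (fun t => ∫ x, ⟪w t x, ψ x⟫) (𝓝[<] 0) (𝓝 (∫ x, ⟪u₀ x, ψ x⟫)) := fun ψ hψ =>
        Theorems.FiniteDissipationLiouville.EnergyTrace.tendsto_pairing_of_energy hw hu₀m hener hψ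
    obtain ⟨ε₀, hε₀, hfl⟩ := Theorems.FiniteDissipationLiouville.EnergyTrace.lintegral_ball_finalDatum_sq_floor C Kc
    obtain ⟨Lg, hLg⟩ := hSIB 1
    have hLv : 0 ≤ max L₁ Lg := hL₁nn.trans (le_max_left _ _)
    have hgradW : ∀ t : ℝ, t < 0 → ∀ x, ‖fderiv ℝ (w t) x‖ ≤ max L₁ Lg / (‖x‖ + Real.sqrt (-t)) ^ 2 := by
      intro t ht x
      have h := (hLg t ht x).1
      rw [← Theorems.FiniteDissipationLiouville.FinalDatumVorticity.norm_fderiv_eq_norm_iteratedFDeriv_one,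
        show (1 + 1 : ℕ) = 2 by norm_num] at h
      have hden : 0 < (‖x‖ + Real.sqrt (-t)) ^ 2 :=
        pow_pos (add_pos_of_nonneg_of_pos (norm_nonneg _) (Real.sqrt_pos.2 (neg_pos.2 ht))) 2
      exact h.trans (div_le_div_of_nonneg_right (le_max_right _ _) hden.le)
    have hgenv' : ∀ x : EuclideanSpace ℝ (Fin 3), x ≠ 0 → ‖Du₀ x‖ ≤ max L₁ Lg / ‖x‖ ^ 2 :=
      fun x hx => (hgenv x hx).trans (div_le_div_of_nonneg_right (le_max_left _ _) (by positivity))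
    have hgrate' : ∀ x : EuclideanSpace ℝ (Fin 3), x ≠ 0 → ∀ t : ℝ, t < 0 →
        ‖fderiv ℝ (w t) x - Du₀ x‖ ≤ max L₁ Lg * (-t) / ‖x‖ ^ 4 := fun x hx t ht =>
      (hgrate x hx t ht).trans (div_le_div_of_nonneg_right
        (mul_le_mul_of_nonneg_right (le_max_left _ _) (neg_nonneg.2 ht.le)) (by positivity))
    have hVnn : (0 : ℝ) ≤ 3 * (MeasureTheory.volume : MeasureTheory.Measure
        (EuclideanSpace ℝ (Fin 3))).real (Metric.ball 0 1) := by positivity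
    obtain ⟨δr, hδr, hrf⟩ := Theorems.FiniteDissipationLiouville.EnergyReturn.remainderEnergy_floor C Kc
    exact h C A Kc w hw (hA w hw hDw hsw) hDw hmin hrec hsat
      ⟨Q, hQcl, hSIB⟩
      (Theorems.FiniteDissipationLiouville.Envelope.dissipation_tail_of_minimal hmin hw hDw hsw)
      ⟨δ₀, hδ₀, T₀, hT₀, hpvw⟩
      ⟨θ, hθ, hsup C w hw hsw⟩
      (fun x₁ hx₁ =>
        Theorems.FiniteDissipationLiouville.CriticalPoint.not_singular_translate_of_minimal
          hw hDw hsw hmin hx₁)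
      (Theorems.FiniteDissipationLiouville.Birth.Apex.exists_trace_ne_zero_of_singular hw hDw hsw)
      (Theorems.FiniteDissipationLiouville.Birth.Apex.trace_L3_concentration_of_singular hw hDw hsw)
      (Theorems.FiniteDissipationLiouville.Birth.Apex.trace_L3_concentration_atInfinity_of_singular
        hw hDw hsw)
      ⟨θ₁, hθ₁, hθ₁f w hw hDw hsw⟩ ⟨θ₂, hθ₂, hθ₂f w hw hDw hsw⟩
      (fun e he R₁ =>
        Theorems.FiniteDissipationLiouville.Birth.Apex.exists_halfSpace_trace_curl_ne_zero_of_singular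
          hw hDw hsw he R₁)
      (fun r hr =>
        Theorems.FiniteDissipationLiouville.Birth.Apex.exists_apex_trace_curl_ne_zero_of_singular
          hw hDw hsw hr)
      ⟨lam₀, hlam₀, fun c hc hcl hpast => hthr w hw hDw c hc hcl hpast hsw⟩
      ⟨θ₃, hθ₃, hθ₃f w hw hDw hsw⟩ ⟨θ₄, hθ₄, hθ₄f w hw hDw hsw⟩
      (fun c hc hc1 hcW =>
        Theorems.FiniteDissipationLiouville.Birth.exists_least_factor_of_pastDss hw
          (Theorems.FiniteDissipationLiouville.Birth.not_forall_eq_zero_of_singular hsw) hc hc1 hcW)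
      ⟨L₀, L₁, Me, u₀, Du₀, hener,
        ⟨δr, hδr, fun t ht => hrf w hw hDw hsw u₀ hu₀m htr t ht
          (ne_top_of_le_ne_top ENNReal.ofReal_ne_top (hener t ht))⟩,
        htr, ⟨ε₀, hε₀, fun ρ hρ => hfl w hw hDw hsw u₀ hu₀m htr ρ hρ
          (ne_top_of_le_ne_top ENNReal.ofReal_ne_top
            (Theorems.FiniteDissipationLiouville.EnergyTrace.lintegral_ball_finalDatum_sq_le henv hρ))⟩,
        fun ρ hρ => Theorems.FiniteDissipationLiouville.EnergyTrace.lintegral_ball_finalDatum_sq_le henv hρ,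
        Theorems.FiniteDissipationLiouville.FinalDatumVorticity.isWeaklyDivFree_finalDatum hw htr,
        ⟨4 * (3 * (3 * (MeasureTheory.volume : MeasureTheory.Measure
            (EuclideanSpace ℝ (Fin 3))).real (Metric.ball 0 1))) * max L₁ Lg, by positivity,
          fun t ht => (Theorems.FiniteDissipationLiouville.FinalDatumVorticity.lintegral_fderiv_sub_finalDatum_le
              hgradW hgenv' hgrate' ht).trans (ENNReal.ofReal_le_ofReal (by
            have hs : 0 ≤ Real.sqrt (-t) := Real.sqrt_nonneg _
            nlinarith [mul_nonneg (mul_nonneg hVnn hLv) hs])),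
          fun t ht => (Theorems.FiniteDissipationLiouville.FinalDatumVorticity.lintegral_curl_sub_finalDatum_le
              hgradW hgenv' hgrate' ht).trans (ENNReal.ofReal_le_ofReal (le_of_eq (by ring))),
          fun ρ hρ => (Theorems.FiniteDissipationLiouville.FinalDatumVorticity.lintegral_ball_curlDatum_le
              hgenv' hρ).trans (ENNReal.ofReal_le_ofReal (by
            nlinarith [mul_nonneg (mul_nonneg hVnn hLv) hρ.le]))⟩,
        fun ψ hψ => Theorems.FiniteDissipationLiouville.FinalDatumVorticity.tendsto_pairing_curl_finalDatum
          hw hgradW hgenv' hgrate' hψ,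
        hrate, henv, hgrate, hgenv, hderiv, hdiv, fun ψ r hr hψ hsupp =>
        Theorems.FiniteDissipationLiouville.FinalDatum.tendsto_pairing_of_rate hw (hA w hw hDw hsw)
          hrate hψ hr hsupp⟩
      ⟨δ₁, hδ₁, hδ₁f w hw hDw hsw⟩
      (Theorems.FiniteDissipationLiouville.VorticityAlignment.not_continuousAlignment_of_singular
        hw hDw hsw)
      ⟨δ₂, hδ₂, hδ₂f w hw hDw hsw⟩
      ⟨δ₃, hδ₃, hδ₃f w hw hDw hsw⟩
      (Theorems.FiniteDissipationLiouville.VorticityAlignment.not_gigaMiuraAlignment_of_singular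
        hw hDw hsw)
      (fun r hr => by
        obtain ⟨δ, hδ, hf⟩ := Theorems.FiniteDissipationLiouville.VorticityAlignment.directionOscillation_floor_local
            C Kc r hr
        exact ⟨δ, hδ, hf w hw hDw hsw⟩)
      (fun r hr => by
        obtain ⟨δ, hδ, hf⟩ := Theorems.FiniteDissipationLiouville.Planarity.planarity_floor_local C Kc r hr
        exact ⟨δ, hδ, hf w hw hDw hsw⟩)
      (fun r hr => by
        obtain ⟨δ, hδ, hf⟩ :=
          Theorems.FiniteDissipationLiouville.Unidirectional.unidirectionality_floor_local C Kc r hr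
        exact ⟨δ, hδ, hf w hw hDw hsw⟩)
      (Theorems.FiniteDissipationLiouville.VorticityAlignment.not_alignment_concentrating_of_singular
        hw hDw hsw)
      (fun r hr => by
        obtain ⟨δ, hδ, hf⟩ := Theorems.FiniteDissipationLiouville.EnergyFloor.coreEnergy_floor_of_singular C Kc r hr
        exact ⟨δ, hδ, hf w hw hDw hsw⟩)
      ⟨Λ, fun x₀ r hr t ht => hΛ C w hw hDw x₀ r hr t ht⟩
      hsw

end Summit.NavierStokesRegularity.NavierStokesRegularity.Theorems.FiniteDissipationLiouville.PortraitReduction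

end
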